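import Summits.Ventures.Crystal3D.Theorems.StickyWulffConstantCoaxialWallLawPayerFamilyEnds
import Summits.Ventures.Crystal3D.Theorems.StickyWulffConstantCoaxialWallLawExactCountAbsPlatesExit
import Summits.Ventures.Crystal3D.Theorems.StickyWulffConstantCoaxialWallLawWordEndsGen
import Summits.Ventures.Crystal3D.Theorems.StickyWulffConstantCoaxialWallLawWordStepGen
import Summits.Ventures.Crystal3D.Theorems.StickyWulffConstantCoaxialWallLawWordDirInjective
import HarnessLib

/-!
# End accounting with the plates abstracted and TOP EXITS COUNTED: the END PAIRS of one word family (F_layer OneFcc, file (B′), family level)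

HONEST FRAMING. Venture `Summits/Ventures/Crystal3D` (cell `crystal3d-full`), helper `--supports` the crux
`CoaxialWallLaw` of `route-Ventures-StickyWulffConstant` (REGISTERED line `WallLedgerF`), in its role as owner of lane T's
debt T-F2 / F_layer, OneFcc half (cf-p1 (civ)/(cxx) «OneFcc = TWO FAMILIES»; memos HOME/wall-19481-p1/g15/ONEFCC-ASSEMBLY-PLAN-g15.md
§CORRECTION, HOME/wall-19481-p1/g16/TWO-FAMILY-LEDGER-g16.md).  Rung credit; F-C1 not moved; inputs `KissingGap δ`, `KissingClassification δ`
by name; census-free.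

This is `word_family_endPairs_plates` (…PayerFamilyEndsPlates, p692…/L2b) VERBATIM — same word data `F, u, WF, next`, same state space, move
map, state invariant `P`, same end pairs `T` with the same five properties — with the TOP EXCLUSION `hPexcl0` («no class reads an occupied face at a
ball of `P₂`») REPLACED by the weaker TOP RIGIDITY

* `hPexit` — a well-formed class carrying the invariant that reads an occupied `60°` face at a ball `b ∈ P₂` IS THE ROOT CLASS (`κ = []`), and
  `b` satisfies the abstract exit predicate `topOK` (for the fcc plate's own tree run into a clamped Barlow plate: `word_eq_nil_of_face_plateBall`
  p696331, and the layer type of `b` is not `c_opp` by `hPexcl0_of_fullTwinPlate` p697004),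

so that walkers MAY enter the top plate, and the census COUNTS these exits (abstract count `word_sources_le_exact_plates_exit`,
…ExactCountAbsPlatesExit): **`word_family_endPairs_plates_exit`** — conclusion identical to `word_family_endPairs_plates` plus ONE term,
`#EXIT` = the balls of `X` in the top sealing band within lateral `ρ − 2` satisfying `topOK` whose root-predecessor `b − F [] (u [])` lies below
the band (one per root line).  With `topOK := fun _ => False` this is p692…'s statement.
WHAT THIS IS NOT: the multi-root union, the OneFcc cell and the flux bound on `#EXIT` are the next files; F-C1 not moved.
-/

noncomputable section

namespace Summit.Ventures.Crystal3D.Theorems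

open Summit.Ventures.Crystal3D Finset
open Literature.MathematicalPhysics.StatisticalMechanics (fccStacking)
open scoped InnerProductSpace

section Instance

variable {X : Finset (EuclideanSpace ℝ (Fin 3))}
  {F : List (EuclideanSpace ℝ (Fin 3)) → (EuclideanSpace ℝ (Fin 3) ≃ₗᵢ[ℝ] EuclideanSpace ℝ (Fin 3))}
  {u : List (EuclideanSpace ℝ (Fin 3)) → EuclideanSpace ℝ (Fin 3)}
  {WF : List (EuclideanSpace ℝ (Fin 3)) → Prop}
  {next : List (EuclideanSpace ℝ (Fin 3)) → EuclideanSpace ℝ (Fin 3) → List (EuclideanSpace ℝ (Fin 3))}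
  {P' P₂ : Finset (EuclideanSpace ℝ (Fin 3))} {R₀ h ρ : ℝ}

open scoped Classical in
/-- **The end pairs of one word family at version `ver` with the plates abstracted and top exits counted.**  See the module docstring. -/
theorem word_family_endPairs_plates_exit (ver : WordVersion) {δ : ℝ} (hg : KissingGap δ) (hc : KissingClassification δ)
    (hX : ∀ p ∈ X, ∀ q ∈ X, p ≠ q → 1 ≤ dist p q)
    (hFc : ∀ μ κ, F (μ :: κ) = ((ℝ ∙ μ)ᗮ.reflection).trans (F κ))
    (hu : ∀ κ, u κ ∈ fccSlots) (huc : ∀ μ κ, u (μ :: κ) = -u κ)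
    (hWF0 : WF [])
    (hWFc : ∀ μ κ, WF (μ :: κ) ↔ (WF κ ∧ ‖μ‖ = 1 ∧
      (∀ w ∈ fccSlots, ⟪w, μ⟫_ℝ = 0 ∨ ⟪w, μ⟫_ℝ = Real.sqrt (2 / 3) ∨ ⟪w, μ⟫_ℝ = -Real.sqrt (2 / 3)) ∧
      ⟪u κ, μ⟫_ℝ = Real.sqrt (2 / 3) ∧ ∀ μ' κ', κ = μ' :: κ' → μ' ≠ -μ))
    (hnext_pop : ∀ μ κ' (m : EuclideanSpace ℝ (Fin 3)), (F (μ :: κ')).symm m = -μ → next (μ :: κ') m = κ')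
    (hnext_push : ∀ κ (m : EuclideanSpace ℝ (Fin 3)), (∀ μ κ', κ = μ :: κ' → (F κ).symm m ≠ -μ) →
      next κ m = (F κ).symm m :: κ)
    -- the top grain's frame and the state invariant (preserved by LEGAL moves)
    {P : EuclideanSpace ℝ (Fin 3) × List (EuclideanSpace ℝ (Fin 3)) → Prop}
    (hPstraight : ∀ (b : EuclideanSpace ℝ (Fin 3)) (κ : List (EuclideanSpace ℝ (Fin 3))), WF κ →
      (IsFull X (F κ) b ∨ (∃ m, IsTwinReading X (F κ) m b ∧ ⟪F κ (u κ), m⟫_ℝ = 0) ∨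
        (ver = WordVersion.v2 ∧ IsNarrow X (F κ) (F κ (u κ)) b)) →
      P (b, κ) → P (b + F κ (u κ), κ))
    (hPcross : ∀ (b : EuclideanSpace ℝ (Fin 3)) (κ : List (EuclideanSpace ℝ (Fin 3))) (m : EuclideanSpace ℝ (Fin 3)),
      WF κ → WF (next κ m) → IsTwinReading X (F κ) m b → ⟪F κ (u κ), m⟫_ℝ = Real.sqrt (2 / 3) →
      P (b, κ) → P (b + F (next κ m) (u (next κ m)), next κ m))
    -- TOP RIGIDITY: a class carrying the invariant that reads an occupied face at a ball of `P₂` is the ROOT class, onto a `topOK` ball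
    (topOK : EuclideanSpace ℝ (Fin 3) → Prop)
    (hPexit : ∀ (b : EuclideanSpace ℝ (Fin 3)) (κ : List (EuclideanSpace ℝ (Fin 3))), WF κ → P (b, κ) → b ∈ P₂ →
      (∃ a ∈ fccSlots, ∃ a' ∈ fccSlots, ∃ a'' ∈ fccSlots,
        ⟪a, a'⟫_ℝ = 1 / 2 ∧ ⟪a, a''⟫_ℝ = 1 / 2 ∧ ⟪a', a''⟫_ℝ = 1 / 2 ∧
        b + F κ a ∈ X ∧ b + F κ a' ∈ X ∧ b + F κ a'' ∈ X) → κ = [] ∧ topOK b)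
    (hup : 0 < (F [] (u [])) 2)
    -- the cell
    (hR₀ : 3 ≤ R₀) (hρ : R₀ ≤ ρ)
    -- the bottom plate's CORE and its SOURCES
    (srcOK : EuclideanSpace ℝ (Fin 3) → Prop)
    (hP'top : ∀ p ∈ P', p 2 ≤ -R₀ - 1)
    (hPsrc : ∀ p ∈ P', srcOK p → p ∈ X ∧
      (∃ a ∈ fccSlots, ∃ a' ∈ fccSlots, ∃ a'' ∈ fccSlots,
        ⟪a, a'⟫_ℝ = 1 / 2 ∧ ⟪a, a''⟫_ℝ = 1 / 2 ∧ ⟪a', a''⟫_ℝ = 1 / 2 ∧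
        p + F [] a ∈ X ∧ p + F [] a' ∈ X ∧ p + F [] a'' ∈ X) ∧
      p - F [] (u []) ∈ X ∧
      (IsFull X (F []) p ∨ (∃ m, IsTwinReading X (F []) m p ∧ ⟪F [] (u []), m⟫_ℝ = 0) ∨
        (ver = WordVersion.v2 ∧ IsNarrow X (F []) (F [] (u [])) p)) ∧
      P (p + F [] (u []), []))
    -- rigidity at the core: a class reading an occupied face at a core ball moves in the root direction
    (hstd : ∀ κ, WF κ → ∀ p ∈ P', (∃ a ∈ fccSlots, ∃ a' ∈ fccSlots, ∃ a'' ∈ fccSlots,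
        ⟪a, a'⟫_ℝ = 1 / 2 ∧ ⟪a, a''⟫_ℝ = 1 / 2 ∧ ⟪a', a''⟫_ℝ = 1 / 2 ∧
        p + F κ a ∈ X ∧ p + F κ a' ∈ X ∧ p + F κ a'' ∈ X) → F κ (u κ) = F [] (u []))
    -- sealing: below the window off the core, and above the window into the top plate
    (hsealB : ∀ s ∈ X, s ∉ P' → -R₀ - 1 - 1 ≤ s 2 → s 2 < -R₀ - 1 → s 0 ^ 2 + s 1 ^ 2 ≤ (ρ - 1) ^ 2 → False)
    (hP₂seal : ∀ s ∈ X, h + R₀ + 1 ≤ s 2 → s 2 ≤ h + R₀ + 1 + 1 → s 0 ^ 2 + s 1 ^ 2 ≤ (ρ - 2) ^ 2 → s ∈ P₂) :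
    ∃ T : Finset (EuclideanSpace ℝ (Fin 3) × EuclideanSpace ℝ (Fin 3)),
      (P'.filter fun p => srcOK p ∧
          -R₀ - 1 < (p + F [] (u [])) 2 ∧ (p + F [] (u [])) 2 < h + R₀ + 1).card ≤
        T.card +
        (X.filter fun b => h + R₀ + 1 ≤ b 2 ∧ b 2 ≤ h + R₀ + 1 + 1 ∧ b 0 ^ 2 + b 1 ^ 2 ≤ (ρ - 2) ^ 2 ∧
          (b - F [] (u [])) 2 < h + R₀ + 1 ∧ topOK b).card +
        220 * (X.filter fun s => h + R₀ + 1 ≤ s 2 ∧ s 2 ≤ h + R₀ + 1 + 1 ∧ (ρ - 2) ^ 2 < s 0 ^ 2 + s 1 ^ 2).card +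
        220 * (X.filter fun s => -R₀ - 1 - 1 ≤ s 2 ∧ s 2 < -R₀ - 1 ∧ (ρ - 1) ^ 2 < s 0 ^ 2 + s 1 ^ 2).card ∧
      (∀ bq ∈ T, bq.1 ∈ X ∧ bq.2 ∈ X ∧ dist bq.1 bq.2 = 1 ∧ -R₀ - 1 ≤ bq.1 2 ∧ bq.1 2 < h + R₀ + 1) ∧
      (∀ bq ∈ T, (X.filter fun q => dist bq.1 q = 1).card ≤ 11 ∨
        ∃ z₁ ∈ X, ∃ z₂ ∈ X, z₁ ≠ z₂ ∧ dist bq.1 z₁ = 1 ∧ dist bq.1 z₂ = 1 ∧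
          (X.filter fun q => dist z₁ q = 1).card ≤ 11 ∧ (X.filter fun q => dist z₂ q = 1).card ≤ 11) ∧
      (∀ bq ∈ T, ∃ κ, WF κ ∧ P (bq.1, κ)) ∧
      (∀ bq ∈ T, ∃ κ, WF κ ∧ bq.2 - F κ (u κ) ∈ X ∧ IsEndMove X ver (F κ) (F κ (u κ)) bq.2 bq.1) := by
  have hr : 0 < Real.sqrt (2 / 3) := Real.sqrt_pos.2 (by norm_num)
  -- the class data on the subtype of well-formed words
  set F' : {κ : List (EuclideanSpace ℝ (Fin 3)) // WF κ} →
      (EuclideanSpace ℝ (Fin 3) ≃ₗᵢ[ℝ] EuclideanSpace ℝ (Fin 3)) := fun κ => F κ.1 with hF'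
  set d' : {κ : List (EuclideanSpace ℝ (Fin 3)) // WF κ} → EuclideanSpace ℝ (Fin 3) :=
    fun κ => F κ.1 (u κ.1) with hd'
  set next' : {κ : List (EuclideanSpace ℝ (Fin 3)) // WF κ} → EuclideanSpace ℝ (Fin 3) →
      {κ : List (EuclideanSpace ℝ (Fin 3)) // WF κ} := fun κ m =>
    @dite _ (WF (next κ.1 m)) (Classical.propDecidable _) (fun hw => ⟨next κ.1 m, hw⟩) (fun _ => κ) with hnext'
  set root : {κ : List (EuclideanSpace ℝ (Fin 3)) // WF κ} := ⟨[], hWF0⟩ with hroot_def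
  -- the class change along a crossing normal
  have hspec : ∀ (κ : {κ : List (EuclideanSpace ℝ (Fin 3)) // WF κ}) (m : EuclideanSpace ℝ (Fin 3)), ‖m‖ = 1 →
      (∀ w ∈ fccSlots, ⟪F' κ w, m⟫_ℝ = 0 ∨ ⟪F' κ w, m⟫_ℝ = Real.sqrt (2 / 3) ∨ ⟪F' κ w, m⟫_ℝ = -Real.sqrt (2 / 3)) →
      ⟪d' κ, m⟫_ℝ = Real.sqrt (2 / 3) →
      (next' κ m).1 = next κ.1 m ∧ (∀ x, F (next κ.1 m) x = F κ.1 x - (2 * ⟪F κ.1 x, m⟫_ℝ) • m) ∧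
        ⟪F (next κ.1 m) (u (next κ.1 m)), m⟫_ℝ = Real.sqrt (2 / 3) ∧ next (next κ.1 m) m = κ.1 := by
    intro κ m hm hmenu hdm
    obtain ⟨hwf, hfr, hdir, hinv⟩ := word_next_spec hFc huc hWFc hnext_pop hnext_push κ.2 hm hmenu hdm
    refine ⟨?_, hfr, hdir, hinv⟩
    simp only [hnext']
    rw [dif_pos hwf]
  have hmirror : ∀ (κ : {κ : List (EuclideanSpace ℝ (Fin 3)) // WF κ}) (m : EuclideanSpace ℝ (Fin 3)), ‖m‖ = 1 →
      (∀ w ∈ fccSlots, ⟪F' κ w, m⟫_ℝ = 0 ∨ ⟪F' κ w, m⟫_ℝ = Real.sqrt (2 / 3) ∨ ⟪F' κ w, m⟫_ℝ = -Real.sqrt (2 / 3)) →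
      ⟪d' κ, m⟫_ℝ = Real.sqrt (2 / 3) → ∀ x, F' (next' κ m) x = F' κ x - (2 * ⟪F' κ x, m⟫_ℝ) • m := by
    intro κ m hm hmenu hdm x
    obtain ⟨h1, hfr, -, -⟩ := hspec κ m hm hmenu hdm
    show F (next' κ m).1 x = F κ.1 x - (2 * ⟪F κ.1 x, m⟫_ℝ) • m
    rw [h1]; exact hfr x
  have hinv : ∀ (κ : {κ : List (EuclideanSpace ℝ (Fin 3)) // WF κ}) (m : EuclideanSpace ℝ (Fin 3)), ‖m‖ = 1 →
      (∀ w ∈ fccSlots, ⟪F' κ w, m⟫_ℝ = 0 ∨ ⟪F' κ w, m⟫_ℝ = Real.sqrt (2 / 3) ∨ ⟪F' κ w, m⟫_ℝ = -Real.sqrt (2 / 3)) →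
      ⟪d' κ, m⟫_ℝ = Real.sqrt (2 / 3) → next' (next' κ m) m = κ := by
    intro κ m hm hmenu hdm
    obtain ⟨h1, -, -, hback⟩ := hspec κ m hm hmenu hdm
    apply Subtype.ext
    have h2 : (next' (next' κ m) m).1 = next (next' κ m).1 m := by
      simp only [hnext']
      rw [dif_pos]
      rw [h1, hback]; exact κ.2
    rw [h2, h1, hback]
  have hdnext : ∀ (κ : {κ : List (EuclideanSpace ℝ (Fin 3)) // WF κ}) (m : EuclideanSpace ℝ (Fin 3)), ‖m‖ = 1 →
      (∀ w ∈ fccSlots, ⟪F' κ w, m⟫_ℝ = 0 ∨ ⟪F' κ w, m⟫_ℝ = Real.sqrt (2 / 3) ∨ ⟪F' κ w, m⟫_ℝ = -Real.sqrt (2 / 3)) →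
      ⟪d' κ, m⟫_ℝ = Real.sqrt (2 / 3) → ⟪d' (next' κ m), m⟫_ℝ = Real.sqrt (2 / 3) := by
    intro κ m hm hmenu hdm
    obtain ⟨h1, -, hdir, -⟩ := hspec κ m hm hmenu hdm
    show ⟪F (next' κ m).1 (u (next' κ m).1), m⟫_ℝ = Real.sqrt (2 / 3)
    rw [h1]; exact hdir
  have hd : ∀ κ : {κ : List (EuclideanSpace ℝ (Fin 3)) // WF κ}, ∃ u' ∈ fccSlots, d' κ = F' κ u' :=
    fun κ => ⟨u κ.1, hu κ.1, rfl⟩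
  have hdn : ∀ κ : {κ : List (EuclideanSpace ℝ (Fin 3)) // WF κ}, ∃ m : EuclideanSpace ℝ (Fin 3), ‖m‖ = 1 ∧
      (∀ w ∈ fccSlots, ⟪F' κ w, m⟫_ℝ = 0 ∨ ⟪F' κ w, m⟫_ℝ = Real.sqrt (2 / 3) ∨ ⟪F' κ w, m⟫_ℝ = -Real.sqrt (2 / 3)) ∧
      ⟪d' κ, m⟫_ℝ = Real.sqrt (2 / 3) := fun κ => exists_menuNormal_far (F κ.1) (hu κ.1)
  -- rigidity: the slot dozen determines the word; the direction determines the word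
  have hinjK : ∀ κ κ' : {κ : List (EuclideanSpace ℝ (Fin 3)) // WF κ},
      (F' κ : EuclideanSpace ℝ (Fin 3) → EuclideanSpace ℝ (Fin 3)) '' ↑fccSlots =
      (F' κ' : EuclideanSpace ℝ (Fin 3) → EuclideanSpace ℝ (Fin 3)) '' ↑fccSlots → κ = κ' :=
    fun κ κ' himg => Subtype.ext (word_eq_of_image_eq hFc huc hWFc κ.2 κ'.2 himg)
  have hdinj : ∀ κ κ' : {κ : List (EuclideanSpace ℝ (Fin 3)) // WF κ}, d' κ = d' κ' → κ = κ' :=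
    fun κ κ' hdd => Subtype.ext (word_dir_injective hFc huc hWFc (hu []) κ.2 κ'.2 hdd)
  -- the certified states and the move map
  obtain ⟨W, hW, hmult⟩ := exists_certified_states (F := F') (d := d') hX hinjK
  obtain ⟨f, hf_full, hf_cross, hf_glide, hf_narrow⟩ := exists_word_move_map_gen X F' d' next' hd
  have htarget : ∀ v ∈ W, IsMoving X ver (F' v.2) (d' v.2) v.1 →
      f v ∈ W ∧ (f v).1 - d' (f v).2 = v.1 ∧ dist v.1 (f v).1 = 1 :=
    fun v hv hm => word_move_target_gen ver hd hdn hmirror hdnext hW (fun v _ => hf_full v)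
      (fun v _ m => hf_cross v m) (fun v _ m => hf_glide v m) (fun v _ _ hn => hf_narrow v hn) hv hm
  have hinjW : Set.InjOn f {v | v ∈ W ∧ IsMoving X ver (F' v.2) (d' v.2) v.1} :=
    word_move_injOn_gen ver hX hd hmirror hinv hdnext (fun v hv => ((hW v).1 hv).2.2) (fun v _ => hf_full v)
      (fun v _ m => hf_cross v m) (fun v _ m => hf_glide v m) (fun v _ _ hn => hf_narrow v hn)
  -- the invariant, lifted to the subtype of well-formed words, along moves
  set Pw : EuclideanSpace ℝ (Fin 3) × {κ : List (EuclideanSpace ℝ (Fin 3)) // WF κ} → Prop :=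
    fun v => P (v.1, v.2.1) with hPwdef
  have hsrc : ∀ p ∈ P', srcOK p → (p, root) ∈ W ∧ IsMoving X ver (F' (p, root).2) (d' (p, root).2) (p, root).1 ∧
      f (p, root) = (p + d' root, root) ∧ Pw (p + d' root, root) := by
    intro p hp hok
    obtain ⟨hpX, htri, hpred, hmv, hP⟩ := hPsrc p hp hok
    have hW' : (p, root) ∈ W := (hW _).2 ⟨hpX, htri, hpred⟩
    rcases hmv with hfull | ⟨m, htd, h0⟩ | ⟨hver, hnar⟩
    · exact ⟨hW', Or.inl hfull, hf_full (p, root) hfull, hP⟩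
    · exact ⟨hW', Or.inr (Or.inl ⟨m, htd, Or.inr h0⟩), hf_glide (p, root) m htd h0, hP⟩
    · exact ⟨hW', Or.inr (Or.inr ⟨hver, hnar⟩), hf_narrow (p, root) hnar, hP⟩
  have hPmov : ∀ v ∈ W, IsMoving X ver (F' v.2) (d' v.2) v.1 → Pw v → Pw (f v) := by
    intro v _ hm hv
    rcases hm with hfull | ⟨m, htd, hdm⟩ | ⟨hver, hnar⟩
    · rw [hf_full v hfull]; exact hPstraight v.1 v.2.1 v.2.2 (Or.inl hfull) hv
    · rcases hdm with hdm | hdm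
      · rw [hf_cross v m htd hdm]
        obtain ⟨h1, -, -, -⟩ := hspec v.2 m htd.1.1 htd.1.2 hdm
        have hwf : WF (next v.2.1 m) := by rw [← h1]; exact (next' v.2 m).2
        show P ((v.1 + F (next' v.2 m).1 (u (next' v.2 m).1), (next' v.2 m).1))
        rw [h1]
        exact hPcross v.1 v.2.1 m v.2.2 hwf htd hdm hv
      · rw [hf_glide v m htd hdm]; exact hPstraight v.1 v.2.1 v.2.2 (Or.inr (Or.inl ⟨m, htd, hdm⟩)) hv
    · rw [hf_narrow v hnar]; exact hPstraight v.1 v.2.1 v.2.2 (Or.inr (Or.inr ⟨hver, hnar⟩)) hv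
  -- no re-entry from the window: a class reading a face at a core ball moves like the root, hence came from below
  have hnoReentry : ∀ v ∈ W, IsMoving X ver (F' v.2) (d' v.2) v.1 → Pw v → -R₀ - 1 ≤ v.1 2 → v.1 2 < h + R₀ + 1 →
      (f v).1 ∉ P' := by
    intro v hvW hm _ hlo _ hP'
    obtain ⟨hfW, hback, -⟩ := htarget v hvW hm
    obtain ⟨-, htri, -⟩ := (hW (f v)).1 hfW
    have hdir : d' (f v).2 = d' root := hstd (f v).2.1 (f v).2.2 (f v).1 hP' htri
    have hv1 : v.1 = (f v).1 - d' root := by rw [← hdir, hback]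
    have h2 : v.1 2 = (f v).1 2 - (F [] (u [])) 2 := by
      rw [hv1]; rfl
    have htop := hP'top _ hP'
    linarith
  -- top sealing + rigidity: a window state stepping into the sealing band of the top plate does so in the ROOT class onto a `topOK` ball
  have hexitT : ∀ v ∈ W, IsMoving X ver (F' v.2) (d' v.2) v.1 → Pw v → -R₀ - 1 ≤ v.1 2 → v.1 2 < h + R₀ + 1 →
      h + R₀ + 1 ≤ (f v).1 2 → (f v).1 2 ≤ h + R₀ + 1 + 1 → (f v).1 0 ^ 2 + (f v).1 1 ^ 2 ≤ (ρ - 2) ^ 2 →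
      (f v).2 = root ∧ topOK (f v).1 := by
    intro v hvW hm hPv _ _ hge hle hlat
    obtain ⟨hfW, -, -⟩ := htarget v hvW hm
    obtain ⟨hfX, htri, -⟩ := (hW (f v)).1 hfW
    obtain ⟨hnil, hok⟩ := hPexit (f v).1 (f v).2.1 (f v).2.2 (hPmov v hvW hm hPv) (hP₂seal _ hfX hge hle hlat) htri
    exact ⟨Subtype.ext hnil, hok⟩
  -- the abstract exact count under the state invariant, plates abstracted, exits counted
  have key := word_sources_le_exact_plates_exit (fun v => IsMoving X ver (F' v.2) (d' v.2) v.1) srcOK topOK (root := root)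
    (P := Pw) hW hmult htarget hinjW hsrc hPmov hnoReentry hR₀ hρ hP'top hsealB hexitT
  -- the end set of the abstract count, in membership form
  obtain ⟨E, hkey, hEmem⟩ : ∃ E : Finset (EuclideanSpace ℝ (Fin 3) × {κ : List (EuclideanSpace ℝ (Fin 3)) // WF κ}),
      (P'.filter fun p => srcOK p ∧
          -R₀ - 1 < (p + F [] (u [])) 2 ∧ (p + F [] (u [])) 2 < h + R₀ + 1).card ≤
        E.card +
        (X.filter fun b => h + R₀ + 1 ≤ b 2 ∧ b 2 ≤ h + R₀ + 1 + 1 ∧ b 0 ^ 2 + b 1 ^ 2 ≤ (ρ - 2) ^ 2 ∧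
          (b - F [] (u [])) 2 < h + R₀ + 1 ∧ topOK b).card +
        220 * (X.filter fun s => h + R₀ + 1 ≤ s 2 ∧ s 2 ≤ h + R₀ + 1 + 1 ∧ (ρ - 2) ^ 2 < s 0 ^ 2 + s 1 ^ 2).card +
        220 * (X.filter fun s => -R₀ - 1 - 1 ≤ s 2 ∧ s 2 < -R₀ - 1 ∧ (ρ - 1) ^ 2 < s 0 ^ 2 + s 1 ^ 2).card ∧
      ∀ v, v ∈ E ↔ v ∈ W ∧ (-R₀ - 1 ≤ v.1 2 ∧ v.1 2 < h + R₀ + 1 ∧ ¬ IsMoving X ver (F' v.2) (d' v.2) v.1 ∧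
        Pw v ∧ ∃ u ∈ W, IsMoving X ver (F' u.2) (d' u.2) u.1 ∧ f u = v) :=
    ⟨_, key, fun v => by simp only [Finset.mem_filter]⟩
  -- the END PAIRS: (end ball, predecessor ball); distinct ends give distinct pairs by direction injectivity
  set T : Finset (EuclideanSpace ℝ (Fin 3) × EuclideanSpace ℝ (Fin 3)) := E.image fun v => (v.1, v.1 - d' v.2) with hT
  have hTcard : T.card = E.card := by
    refine Finset.card_image_of_injOn ?_
    intro v₁ _ v₂ _ heq
    simp only [Prod.mk.injEq] at heq
    obtain ⟨h1, h2⟩ := heq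
    have hdd : d' v₁.2 = d' v₂.2 := by
      have := h2; rw [h1] at this; exact sub_right_injective this
    exact Prod.ext h1 (hdinj _ _ hdd)
  refine ⟨T, by rw [hTcard]; exact hkey, ?_, ?_, ?_, ?_⟩
  · -- balls, contact, window
    intro bq hbq
    obtain ⟨v, hv, rfl⟩ := mem_image.1 hbq
    obtain ⟨hvW, h1, h2, -, -, -⟩ := (hEmem v).1 hv
    obtain ⟨hbX, -, hpred⟩ := (hW v).1 hvW
    obtain ⟨u', hu', hdu⟩ := hd v.2
    refine ⟨hbX, hpred, ?_, h1, h2⟩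
    show dist v.1 (v.1 - d' v.2) = 1
    rw [dist_eq_norm, sub_sub_cancel, hdu, LinearIsometryEquiv.norm_map, norm_eq_one_of_mem_fccSlots hu']
  · -- the two-payer dichotomy
    intro bq hbq
    obtain ⟨v, hv, rfl⟩ := mem_image.1 hbq
    obtain ⟨hvW, -, -, hnm, -, -⟩ := (hEmem v).1 hv
    obtain ⟨hnf, hnt⟩ := not_full_not_twin_of_not_isMoving hnm
    exact certified_end_two_payers hg hc hX hd hW hvW hnf hnt
  · -- the invariant at the end ball
    intro bq hbq
    obtain ⟨v, hv, rfl⟩ := mem_image.1 hbq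
    obtain ⟨-, -, -, -, hP, -⟩ := (hEmem v).1 hv
    exact ⟨v.2.1, v.2.2, hP⟩
  · -- the moving predecessor and the non-moving target: `IsEndMove`
    intro bq hbq
    obtain ⟨v, hv, rfl⟩ := mem_image.1 hbq
    obtain ⟨-, -, -, hnm, -, u', hu'W, hum, hfu⟩ := (hEmem v).1 hv
    obtain ⟨-, hback, -⟩ := htarget u' hu'W hum
    rw [hfu] at hback
    obtain ⟨-, -, hpredu⟩ := (hW u').1 hu'W
    -- the pair is `((f u').1, u'.1)`
    have hpair : (v.1, v.1 - d' v.2) = ((f u').1, u'.1) := by rw [← hback, hfu]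
    have hv1 : v.1 = (f u').1 := by rw [hfu]
    rw [hpair]
    refine ⟨u'.2.1, u'.2.2, hpredu, ?_⟩
    -- the non-moving clause of the END state `v = f u'`
    have hnm' : ¬ IsMoving X ver (F v.2.1) (F v.2.1 (u v.2.1)) v.1 := hnm
    rcases hum with hfull | ⟨m, htd, hdm⟩ | ⟨hver, hnar⟩
    · -- straight from a full shell
      have hf := hf_full u' hfull
      have hv2 : v.2 = u'.2 := by rw [← hfu, hf]
      have e1 : v.1 = u'.1 + d' u'.2 := by rw [hv1, hf]
      rw [hv2, e1] at hnm'
      left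
      exact ⟨Or.inl hfull, by rw [hf], by rw [hf]; exact hnm'⟩
    · rcases hdm with hcr | hgl
      · -- cross along `m`
        have hf := hf_cross u' m htd hcr
        obtain ⟨h1, hfr, -, -⟩ := hspec u'.2 m htd.1.1 htd.1.2 hcr
        have hdir : F (next' u'.2 m).1 (u (next' u'.2 m).1) =
            -(F u'.2.1 (u u'.2.1) - (2 * ⟪F u'.2.1 (u u'.2.1), m⟫_ℝ) • m) := by
          rw [h1, hfr, word_u_next huc hnext_pop hnext_push, map_neg, inner_neg_left]
          module
        have htarget' : u'.1 + F (next' u'.2 m).1 (u (next' u'.2 m).1) =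
            u'.1 - (F u'.2.1 (u u'.2.1) - (2 * ⟪F u'.2.1 (u u'.2.1), m⟫_ℝ) • m) := by
          rw [hdir]; abel
        have hv2 : v.2 = next' u'.2 m := by rw [← hfu, hf]
        have e1 : v.1 = u'.1 + d' (next' u'.2 m) := by rw [hv1, hf]
        -- the new class's frame is the mirrored frame, its direction is `b − q`
        have hG : F (next' u'.2 m).1 = (F u'.2.1).trans (ℝ ∙ m)ᗮ.reflection :=
          LinearIsometryEquiv.ext fun x => by
            rw [h1, hfr, LinearIsometryEquiv.trans_apply, reflection_unit_apply htd.1.1]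
        have hbq : d' (next' u'.2 m) = (u'.1 + d' (next' u'.2 m)) - u'.1 := by abel
        right
        refine ⟨m, htd, hcr, by rw [hf]; exact htarget', ?_⟩
        rw [hf]
        dsimp only
        rw [hv2, e1] at hnm'
        have hnm'' : ¬ IsMoving X ver (F (next' u'.2 m).1) (d' (next' u'.2 m)) (u'.1 + d' (next' u'.2 m)) := hnm'
        rw [hG] at hnm''
        rw [hbq] at hnm''
        simpa only [add_sub_cancel_left] using hnm''
      · -- glide along `m`
        have hf := hf_glide u' m htd hgl
        have hv2 : v.2 = u'.2 := by rw [← hfu, hf]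
        have e1 : v.1 = u'.1 + d' u'.2 := by rw [hv1, hf]
        rw [hv2, e1] at hnm'
        left
        exact ⟨Or.inr (Or.inr ⟨m, htd, hgl⟩), by rw [hf], by rw [hf]; exact hnm'⟩
    · -- narrow (version `v2`)
      have hf := hf_narrow u' hnar
      have hv2 : v.2 = u'.2 := by rw [← hfu, hf]
      have e1 : v.1 = u'.1 + d' u'.2 := by rw [hv1, hf]
      rw [hv2, e1] at hnm'
      left
      exact ⟨Or.inr (Or.inl ⟨hver, hnar⟩), by rw [hf], by rw [hf]; exact hnm'⟩

end Instance

end Summit.Ventures.Crystal3D.Theorems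

end
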